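import Literature.IUT.HodgeTheaters.PiAvatarNFCuspLabelsAut
import Literature.IUT.HodgeTheaters.PiAvatarNFSide
import HarnessLib

/-!
# The Type-0 NF-kit label slots at the genuine `𝒟^⊚` ([IUTchI] Def 4.1 (v)(vi), Ex 4.3 (i)(ii), Ex 4.5 (ii)): `nfAtV`, `projAt`,
# markings of isomorphs, the character of an isomorphism, `GLabNF := 𝔽_l^⋇` with its transport, `[ε] ↦ 1` — and the
# comparison with the genuine label classes `LabCusp(𝒟^⊚)` (post-freeze additive D13 instance piece, L5-lead RULINGS #46 (1) GO (b);
# small defs + proofs; not a cone member)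

S. Mochizuki, *Inter-universal Teichmüller theory I*, kurims manuscript (May 2020), Def 4.1 (v) p. 97 («`LabCusp(†𝒟^⊚)` … admits a
natural `𝔽_l^⋇`-torsor structure»), (vi) p. 97 («a poly-morphism `†𝒟_v → †𝒟^⊚` [is] a collection of morphisms `†𝒟_v → †𝒟^⊚`»),
Prop 4.2 p. 98 («natural bijection `LabCusp(†𝔇) ⥲ 𝔽_l^⋇`»), Ex 4.3 (i) p. 99 («`Aut(C̲_K)/Aut_ε̲(C̲_K) ⥲ 𝔽_l^⋇`»), (ii) p. 99 («`φ^NF_{•,v}`»),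
Ex 4.5 (ii) p. 108 («`[ε] ↦ η_v`»), Def 6.1 (v) p. 158 («double covering `𝒟^{⊚±} → 𝒟^⊚`») ([IUTchI] Def 4.1 (v) p.97)
[claim: Mochizuki2012, status: disputed] (D-0012 claim key, series status DISPUTED — definitions + kernel theorems over abc-iut-L5-t2's
REAL `InitialThetaData`, abc-iut-L5-t1's `CuspGalois`, binder `hS : D.CuspClassesNormaliserStable`; nothing of the series is asserted,
no side is taken on [IUTchIII] Cor. 3.12).

WHY (abc-iut-L5-t3 = single writer of the NF-side kit `PMBaseKit.NFKit`, RULINGS #31/#43/#46).  `NFKit K` (KitNFSide) has its label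
slots in `Type 0` (`GLabNF : GlobNF → Type`, like abc-iut-L5-t3's `BaseThetaDatum.LabCusp`; gen-4 design finding (3)), whereas the
genuine label classes `LabCusp(𝒟^⊚) = (D.gLabPMModel CG).AbsStar` (PiAvatarNFCuspLabels) live in the universe of `F̄`.  The slot
VALUES at D13 are therefore the CANONICAL LABELLING of Prop 4.2 / Def 4.1 (v): `GLabNF Y := 𝔽_l^⋇`, on which an isomorphism
`b : X ⥲ Y` of isomorphs of `𝒟^⊚` acts by multiplication by its CHARACTER `nfIsoChar b ∈ 𝔽_l^⋇` (= `toFlStarNF` of the induced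
automorphism of `𝒟^⊚` through chosen markings `gnfModel ≅ X` — abc-iut-L5-t4's plan (2) for the `±` side), `[ε] := 1`.  This file
DEFINES those values with the four `NFKit` laws as theorems, and PROVES they are the genuine object up to the canonical bijection:
`absStarEquiv : LabCusp(𝒟^⊚) ⥲ 𝔽_l^⋇` carries `gLabNFAutModel α` to multiplication by `toFlStarNF α` (`absStarEquiv_gLabNFAutModel`),
carries the class `[ε̲] = {ε′, ε″}` to `1` (`absStarEquiv_epsClass`), and `nfIsoChar` of a model automorphism IS `toFlStarNF`
(`nfIsoChar_eq_toFlStarNF`).  The law `exists_aut_smul` (Ex 4.3 (i) surjectivity) is shown EQUIVALENT to the surjectivity of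
`toFlStarNF` (`exists_aut_smul_iff_surjective`) — BOOKED, NOT CLAIMED (G-w4d065g3-1 / abc-iut-L5-t8's torsion monodromy).  The
assembly `D.nfKit : (D.baseKit).NFKit` waits on abc-iut-L5-t4's `InitialThetaData.baseKit`; the local slots `LabStar := 𝔽_l^⋇`,
`labStarIso := refl`, `ηStar := 1` are one-liners there; `labPull` (Ex 4.5 (i)) is GAP row NFK-4 (local cusps at `locModelObj`).
No instance/notation; typed ≠ proved elsewhere.
-/

noncomputable section

namespace Literature.IUT.HodgeTheaters

open CategoryTheory

universe u v w

/-- (plumbing) `m⁻¹ * a * m = a` in a commutative group. [folklore] -/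
private theorem inv_mul_conj_eq {G : Type} [CommGroup G] (m a : G) : m⁻¹ * a * m = a := by
  rw [mul_comm m⁻¹ a, mul_assoc, inv_mul_cancel, mul_one]

/-- (plumbing) `(x * y) * c = y * (x * c)` in a commutative group. [folklore] -/
private theorem mul_mul_comm_right {G : Type} [CommGroup G] (x y c : G) : x * y * c = y * (x * c) := by
  rw [mul_comm x y, mul_assoc]

section NFKitSlots

variable {F : Type u} {K : Type v} {Fbar : Type w} [Field F] [NumberField F] [Field K] [NumberField K]
  [Algebra F K] [Field Fbar] [Algebra F Fbar] [Algebra K Fbar]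
  {E : WeierstrassCurve F} [E.IsElliptic] {l : ℕ} {Pb : BadPlacePredicates K}
  (D : InitialThetaData F K Fbar E l Pb) (CG : D.geom.pe.CuspGalois) (hS : D.CuspClassesNormaliserStable)

namespace InitialThetaData

/-! ### `nfAtV`, `projAt` (Def 4.1 (vi), Def 6.1 (v)) -/

/-- **NF-kit slot `nfAtV`**: an isomorph `†𝒟^⊚` "seen at `v`" — under design D1 (one ambient orbit category for every `v`) the
inclusion of the isomorphs of `𝒟^⊚` into the ambient. ([IUTchI] Def 4.1 (vi) p.97) [claim: Mochizuki2012, status: disputed] -/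
abbrev nfAtV : D.GlobNF ⥤ D.PiAmbient := ObjectProperty.ι D.IsGlobNFIsomorph

/-- `nfAtV 𝒟^⊚ = ℬ(Π_{C̲_K})⁰`. ([IUTchI] Def 4.1 (v) p.97) [claim: Mochizuki2012, status: disputed] -/
theorem nfAtV_obj_gnfModel : D.nfAtV.obj D.gnfModel = D.gBaseObj := rfl

/-- **NF-kit slot `projAt`** = abc-iut-L5-t4's double covering `globCover : 𝒟^{⊚±} ⟶ 𝒟^⊚`, typed against `nfAtV` (the kit's
`atV v` is the identity functor under D1). ([IUTchI] Def 6.1 (v) p.158) [claim: Mochizuki2012, status: disputed] -/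
abbrev projAtSlot : D.gModelObj ⟶ D.nfAtV.obj D.gnfModel := D.globCover

/-- **NF-kit law `phiNF_eq` at good `v̲`**: `φ^NF_{•,v̲} = φ^{Θell}_{•,v̲} ≫ projAt` (abc-iut-L5-t3 `phiNFAt_eq`).
([IUTchI] Ex 4.3 (ii) p.99) [claim: Mochizuki2012, status: disputed] -/
theorem phiNFAt_eq_phiEllAt_projAtSlot (Gv : Subgroup (Fbar ≃ₐ[F] Fbar)) :
    D.phiNFAt Gv = D.phiEllAt Gv ≫ D.projAtSlot := D.phiNFAt_eq Gv

/-! ### Automorphisms of the object `gnfModel` of `GlobNF` = automorphisms of `𝒟^⊚` in the ambient -/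

/-- The underlying ambient automorphism of `𝒟^⊚ = ℬ(Π_{C̲_K})⁰` of an automorphism of the object `gnfModel` of the full
subcategory `GlobNF` (the inclusion is fully faithful). ([IUTchI] Def 4.1 (v) p.97) [claim: Mochizuki2012, status: disputed] -/
def autObj (b : D.gnfModel ≅ D.gnfModel) : Aut (D.gBaseObj) where
  hom := b.hom.hom
  inv := b.inv.hom
  hom_inv_id := ObjectProperty.isoHom_inv_id_hom b
  inv_hom_id := ObjectProperty.isoInv_hom_id_hom b

/-- `(autObj b).hom = b.hom.hom`. ([IUTchI] Def 4.1 (v) p.97) [claim: Mochizuki2012, status: disputed] -/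
@[simp] theorem autObj_hom (b : D.gnfModel ≅ D.gnfModel) : (D.autObj b).hom = b.hom.hom := rfl

/-- `autObj (refl) = 1`. ([IUTchI] Def 4.1 (v) p.97) [claim: Mochizuki2012, status: disputed] -/
theorem autObj_refl : D.autObj (Iso.refl _) = 1 := Iso.ext rfl

/-- `autObj (i ≪≫ j) = autObj j * autObj i` (`Aut` multiplies by `f * g = g ≫ f`). ([IUTchI] Def 4.1 (v) p.97) [claim: Mochizuki2012, status: disputed] -/
theorem autObj_trans (i j : D.gnfModel ≅ D.gnfModel) : D.autObj (i ≪≫ j) = D.autObj j * D.autObj i := Iso.ext rfl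

/-- `autObj i.symm = (autObj i)⁻¹`. ([IUTchI] Def 4.1 (v) p.97) [claim: Mochizuki2012, status: disputed] -/
theorem autObj_symm (i : D.gnfModel ≅ D.gnfModel) : D.autObj i.symm = (D.autObj i)⁻¹ := Iso.ext rfl

/-- Every ambient automorphism of `𝒟^⊚` is `autObj` of an automorphism of `gnfModel` (full subcategory).
([IUTchI] Def 4.1 (v) p.97) [claim: Mochizuki2012, status: disputed] -/
theorem autObj_isoMk (α : Aut (D.gBaseObj)) :
    D.autObj ((D.IsGlobNFIsomorph).isoMk (X := D.gnfModel) (Y := D.gnfModel) α) = α := Iso.ext rfl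

/-! ### Markings of isomorphs and the automorphism of `𝒟^⊚` induced by an isomorphism of isomorphs -/

/-- A chosen marking `𝒟^⊚ ⥲ Y` of an isomorph `Y` (exists: `gnfIso`). ([IUTchI] Def 4.1 (v) p.97) [claim: Mochizuki2012, status: disputed] -/
def gnfMarking (Y : D.GlobNF) : D.gnfModel ≅ Y := (D.gnfIso Y).some.symm

/-- The automorphism of `𝒟^⊚ = ℬ(Π_{C̲_K})⁰` induced by an isomorphism `b : X ⥲ Y` of isomorphs through the markings:
`μ_X ≫ b ≫ μ_Y⁻¹`, read in the ambient (abc-iut-L5-t4's plan (2) «chosen markings», NF side).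
([IUTchI] Def 4.1 (v) p.97) [claim: Mochizuki2012, status: disputed] -/
def isoToAut {X Y : D.GlobNF} (b : X ≅ Y) : Aut (D.gBaseObj) :=
  D.autObj (D.gnfMarking X ≪≫ b ≪≫ (D.gnfMarking Y).symm)

/-- `isoToAut (refl) = 1`. ([IUTchI] Def 4.1 (v) p.97) [claim: Mochizuki2012, status: disputed] -/
theorem isoToAut_refl (Y : D.GlobNF) : D.isoToAut (Iso.refl Y) = 1 := by
  rw [isoToAut, Iso.refl_trans, Iso.self_symm_id, autObj_refl]

/-- `isoToAut (b ≪≫ b′) = isoToAut b′ * isoToAut b` (the inner markings cancel). ([IUTchI] Def 4.1 (v) p.97) [claim: Mochizuki2012, status: disputed] -/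
theorem isoToAut_trans {X Y Z : D.GlobNF} (b : X ≅ Y) (b' : Y ≅ Z) :
    D.isoToAut (b ≪≫ b') = D.isoToAut b' * D.isoToAut b := by
  have h : D.gnfMarking X ≪≫ (b ≪≫ b') ≪≫ (D.gnfMarking Z).symm =
      (D.gnfMarking X ≪≫ b ≪≫ (D.gnfMarking Y).symm) ≪≫ (D.gnfMarking Y ≪≫ b' ≪≫ (D.gnfMarking Z).symm) := by
    simp only [Iso.trans_assoc, Iso.symm_self_id_assoc]
  rw [isoToAut, isoToAut, isoToAut, h, autObj_trans]

/-- Every automorphism of `𝒟^⊚` in the ambient is `isoToAut` of an automorphism of the object `gnfModel` of `GlobNF` (conjugate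
a lift by the marking). ([IUTchI] Def 4.1 (v) p.97) [claim: Mochizuki2012, status: disputed] -/
theorem isoToAut_surjective_model (α : Aut (D.gBaseObj)) : ∃ b : D.gnfModel ≅ D.gnfModel, D.isoToAut b = α := by
  refine ⟨(D.gnfMarking D.gnfModel).symm ≪≫ (D.IsGlobNFIsomorph).isoMk (X := D.gnfModel) (Y := D.gnfModel) α ≪≫
    D.gnfMarking D.gnfModel, ?_⟩
  rw [isoToAut]
  have h : D.gnfMarking D.gnfModel ≪≫ ((D.gnfMarking D.gnfModel).symm ≪≫
      (D.IsGlobNFIsomorph).isoMk (X := D.gnfModel) (Y := D.gnfModel) α ≪≫ D.gnfMarking D.gnfModel) ≪≫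
        (D.gnfMarking D.gnfModel).symm = (D.IsGlobNFIsomorph).isoMk (X := D.gnfModel) (Y := D.gnfModel) α := by
    simp only [Iso.trans_assoc, Iso.self_symm_id_assoc, Iso.self_symm_id, Iso.trans_refl]
  rw [h, autObj_isoMk]

variable [Fact l.Prime]

/-! ### The character of an isomorphism of isomorphs -/

/-- **The character `nfIsoChar b ∈ 𝔽_l^⋇` of an isomorphism `b : X ⥲ Y` of isomorphs of `𝒟^⊚`**: `toFlStarNF` of the induced
automorphism of `𝒟^⊚` (Ex 4.3 (i): the image in `Aut(C̲_K)/Aut_ε̲(C̲_K) ⥲ 𝔽_l^⋇`). ([IUTchI] Ex 4.3 (i) p.99) [claim: Mochizuki2012, status: disputed] -/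
def nfIsoChar {X Y : D.GlobNF} (b : X ≅ Y) : FlStar l := D.toFlStarNF CG hS (D.isoToAut b)

/-- `nfIsoChar (refl) = 1`. ([IUTchI] Ex 4.3 (i) p.99) [claim: Mochizuki2012, status: disputed] -/
theorem nfIsoChar_refl (Y : D.GlobNF) : D.nfIsoChar CG hS (Iso.refl Y) = 1 := by
  rw [nfIsoChar, isoToAut_refl, map_one]

/-- `nfIsoChar (b ≪≫ b′) = nfIsoChar b * nfIsoChar b′` (`𝔽_l^⋇` is commutative). ([IUTchI] Ex 4.3 (i) p.99) [claim: Mochizuki2012, status: disputed] -/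
theorem nfIsoChar_trans {X Y Z : D.GlobNF} (b : X ≅ Y) (b' : Y ≅ Z) :
    D.nfIsoChar CG hS (b ≪≫ b') = D.nfIsoChar CG hS b * D.nfIsoChar CG hS b' := by
  rw [nfIsoChar, nfIsoChar, nfIsoChar, isoToAut_trans, map_mul]
  exact mul_comm (D.toFlStarNF CG hS (D.isoToAut b')) (D.toFlStarNF CG hS (D.isoToAut b))

/-- On automorphisms of the model object the character IS `toFlStarNF` of the underlying automorphism of `𝒟^⊚` (the marking
conjugation is invisible in the commutative `𝔽_l^⋇`). ([IUTchI] Ex 4.3 (i) p.99) [claim: Mochizuki2012, status: disputed] -/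
theorem nfIsoChar_eq_toFlStarNF (b : D.gnfModel ≅ D.gnfModel) :
    D.nfIsoChar CG hS b = D.toFlStarNF CG hS (D.autObj b) := by
  rw [nfIsoChar, isoToAut, autObj_trans, autObj_trans, autObj_symm, map_mul, map_mul, map_inv]
  exact inv_mul_conj_eq (G := FlStar l) _ _

/-! ### The Type-0 slot `GLabNF := 𝔽_l^⋇` with its transport by the character -/

/-- **NF-kit slot `gLabNFMap` at D13**: an isomorphism `b : X ⥲ Y` of isomorphs transports labels by multiplication by its
character (`GLabNF := 𝔽_l^⋇`, the canonical labelling of Prop 4.2; justified by `absStarEquiv_gLabNFAutModel` below).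
([IUTchI] Def 4.1 (v) p.97) [claim: Mochizuki2012, status: disputed] -/
def gLabNFMapSlot {X Y : D.GlobNF} (b : X ≅ Y) : FlStar l ≃ FlStar l := Equiv.mulLeft (D.nfIsoChar CG hS b)

/-- `gLabNFMapSlot b c = nfIsoChar b * c`. ([IUTchI] Def 4.1 (v) p.97) [claim: Mochizuki2012, status: disputed] -/
@[simp] theorem gLabNFMapSlot_apply {X Y : D.GlobNF} (b : X ≅ Y) (c : FlStar l) :
    D.gLabNFMapSlot CG hS b c = D.nfIsoChar CG hS b * c := rfl

/-- **NF-kit law `isTorsor_gLabNF`** at D13: `𝔽_l^⋇` acting on itself is a torsor. ([IUTchI] Def 4.1 (v) p.97) [claim: Mochizuki2012, status: disputed] -/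
theorem isTorsor_gLabNFSlot : IsTorsor (FlStar l) (FlStar l) := IsTorsor.self

/-- **NF-kit law `gLabNFMap_smul`** at D13 (equivariance). ([IUTchI] Def 4.1 (v) p.97) [claim: Mochizuki2012, status: disputed] -/
theorem gLabNFMapSlot_smul {X Y : D.GlobNF} (b : X ≅ Y) (j c : FlStar l) :
    D.gLabNFMapSlot CG hS b (j • c) = j • D.gLabNFMapSlot CG hS b c := by
  rw [gLabNFMapSlot_apply, gLabNFMapSlot_apply, smul_eq_mul, smul_eq_mul]
  exact mul_left_comm (D.nfIsoChar CG hS b) j c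

/-- **NF-kit law `gLabNFMap_refl`** at D13. ([IUTchI] Def 4.1 (v) p.97) [claim: Mochizuki2012, status: disputed] -/
theorem gLabNFMapSlot_refl (Y : D.GlobNF) : D.gLabNFMapSlot CG hS (Iso.refl Y) = Equiv.refl _ := by
  ext c
  rw [gLabNFMapSlot_apply, nfIsoChar_refl, one_mul, Equiv.refl_apply]

/-- **NF-kit law `gLabNFMap_trans`** at D13. ([IUTchI] Def 4.1 (v) p.97) [claim: Mochizuki2012, status: disputed] -/
theorem gLabNFMapSlot_trans {X Y Z : D.GlobNF} (b : X ≅ Y) (b' : Y ≅ Z) :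
    D.gLabNFMapSlot CG hS (b ≪≫ b') = (D.gLabNFMapSlot CG hS b).trans (D.gLabNFMapSlot CG hS b') := by
  ext c
  rw [Equiv.trans_apply, gLabNFMapSlot_apply, gLabNFMapSlot_apply, gLabNFMapSlot_apply, nfIsoChar_trans]
  exact mul_mul_comm_right (G := FlStar l) _ _ _

/-- **NF-kit law `exists_aut_smul` at D13 ⟺ surjectivity of `toFlStarNF : Aut(𝒟^⊚) → 𝔽_l^⋇`** (Ex 4.3 (i) «`Aut(C̲_K)/Aut_ε̲(C̲_K)
⥲ 𝔽_l^⋇`»: the instance law BOOKED-NOT-CLAIMED — G-w4d065g3-1 / abc-iut-L5-t8's torsion monodromy — stated as an equivalence).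
([IUTchI] Ex 4.3 (i) p.99) [claim: Mochizuki2012, status: disputed] -/
theorem exists_aut_smul_iff_surjective :
    (∀ j : FlStar l, ∃ b : D.gnfModel ≅ D.gnfModel, ∀ c : FlStar l, D.gLabNFMapSlot CG hS b c = j • c) ↔
      Function.Surjective (D.toFlStarNF CG hS) := by
  constructor
  · intro h α'
    obtain ⟨b, hb⟩ := h α'
    refine ⟨D.isoToAut b, ?_⟩
    have h1 := hb 1
    rwa [gLabNFMapSlot_apply, smul_eq_mul, mul_one, mul_one] at h1
  · intro h j
    obtain ⟨α, hα⟩ := h j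
    obtain ⟨b, hb⟩ := D.isoToAut_surjective_model α
    refine ⟨b, fun c => ?_⟩
    rw [gLabNFMapSlot_apply, smul_eq_mul, nfIsoChar, hb, hα]

/-! ### Comparison with the genuine label classes `LabCusp(𝒟^⊚) = (D.gLabPMModel CG).AbsStar` -/

/-- **The canonical labelling intertwines the genuine action with the slot action**: `absStarEquiv (α·q) = toFlStarNF α * absStarEquiv q`
(`PiAvatarNFCuspLabelsAut.absStarLabel_gLabNFAutModel`). ([IUTchI] Ex 4.3 (i) p.99) [claim: Mochizuki2012, status: disputed] -/
theorem absStarEquiv_gLabNFAutModel (α : Aut (D.gBaseObj)) (q : (D.gLabPMModel CG).AbsStar) :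
    (D.gLabPMModel CG).absStarEquiv (D.gLabNFAutModel CG hS α q) =
      D.toFlStarNF CG hS α * (D.gLabPMModel CG).absStarEquiv q := by
  rw [FlPMGroup.absStarEquiv_apply, FlPMGroup.absStarEquiv_apply]
  exact D.absStarLabel_gLabNFAutModel CG hS α q

/-- **For automorphisms `b` of the model object of `GlobNF`: the slot transport IS the genuine label action** read through the
canonical bijection — `gLabNFMapSlot b (absStarEquiv q) = absStarEquiv (gLabNFAutModel (autObj b) q)`.
([IUTchI] Def 4.1 (v) p.97) [claim: Mochizuki2012, status: disputed] -/
theorem gLabNFMapSlot_absStarEquiv (b : D.gnfModel ≅ D.gnfModel) (q : (D.gLabPMModel CG).AbsStar) :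
    D.gLabNFMapSlot CG hS b ((D.gLabPMModel CG).absStarEquiv q) =
      (D.gLabPMModel CG).absStarEquiv (D.gLabNFAutModel CG hS (D.autObj b) q) := by
  rw [gLabNFMapSlot_apply, nfIsoChar_eq_toFlStarNF, absStarEquiv_gLabNFAutModel]

/-! ### `[ε] ↦ 1`: the class of the cusp `ε̲` of `C̲_K` has label `1` -/

/-- `gChart₀ ε″ = −1` (`ε″ = ι̲ ε′` and `ι̲` reads `z ↦ −z`). ([IUTchI] §1 p.37) [claim: Mochizuki2012, status: disputed] -/
theorem gChart₀Model_ε2 : D.gChart₀Model CG D.geom.pe.ε2 = -1 := by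
  obtain ⟨c, hc, hcX⟩ := SetLike.not_le_iff_exists.mp D.pe_not_PiCbar_le_PiX
  have h := CG.labChart_act_of_not_mem_PiX D.geom.PiXbar_relIndex hc hcX D.geom.pe.ε1
  rw [CG.act_ε1 c hc hcX, CG.labChart_ε1] at h
  exact h

/-- **The cusp `ε̲` of `C̲_K` as a label class**: the `±`-class `{ε′, ε″}` of the two cusps of `X̲_K` over `ε̲` (Def 3.1 (f); §1 «`ε′, ε″`
the two cusps of `X̲` that lie over `ε̲`»), a NONZERO class. ([IUTchI] Ex 4.5 (ii) p.108) [claim: Mochizuki2012, status: disputed] -/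
def epsClass : (D.gLabPMModel CG).AbsStar :=
  ⟨(D.gLabPMModel CG).toAbs D.geom.pe.ε1, fun h => one_ne_zero (by
    rw [(D.gLabPMModel CG).toAbs_eq_toAbs_zero_iff,
      ← (D.gLabPMModel CG).chart_eq_zero_iff (D.gChart₀Model_mem_gLabPMModel_charts CG), D.gChart₀Model_ε1 CG] at h
    exact h)⟩

/-- `ε″` lies in the same class (`ε″ = −ε′` in the chart). ([IUTchI] §1 p.37) [claim: Mochizuki2012, status: disputed] -/
theorem toAbs_ε2_eq_epsClass : (D.gLabPMModel CG).toAbs D.geom.pe.ε2 = (D.epsClass CG).1 := by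
  change (D.gLabPMModel CG).toAbs D.geom.pe.ε2 = (D.gLabPMModel CG).toAbs D.geom.pe.ε1
  rw [(D.gLabPMModel CG).toAbs_eq_toAbs_iff]
  right
  apply (D.gChart₀Model CG).injective
  rw [(D.gLabPMModel CG).chart_neg (D.gChart₀Model_mem_gLabPMModel_charts CG), D.gChart₀Model_ε1 CG, D.gChart₀Model_ε2 CG,
    neg_neg]

/-- **`[ε̲] ↦ 1`**: the canonical labelling sends the class of `ε̲` to `1 ∈ 𝔽_l^⋇` — the NF-kit slot `εLab := 1` IS print's `[ε]`
(and `[ε] ↦ η_v = 1` along `φ^NF_{•,v}`, Ex 4.5 (ii), once the local slots read `LabStar := 𝔽_l^⋇`, `ηStar := 1`).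
([IUTchI] Ex 4.5 (ii) p.108) [claim: Mochizuki2012, status: disputed] -/
theorem absStarEquiv_epsClass : (D.gLabPMModel CG).absStarEquiv (D.epsClass CG) = 1 := by
  rw [FlPMGroup.absStarEquiv_apply, epsClass, (D.gLabPMModel CG).absStarLabel_mk,
    (D.gLabPMModel CG).starLabelOf_eq_of_mem (D.gChart₀Model_mem_gLabPMModel_charts CG) _ _
      (by rw [D.gChart₀Model_ε1 CG]; exact one_ne_zero)]
  have h : Units.mk0 (D.gChart₀Model CG D.geom.pe.ε1) (by rw [D.gChart₀Model_ε1 CG]; exact one_ne_zero) = 1 :=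
    Units.ext (by rw [Units.val_mk0, D.gChart₀Model_ε1 CG, Units.val_one])
  rw [h]
  rfl

/-- The class of `ε̲` is abc-iut-L5-t3's `±`-canonical class `etaPMAbs` of the `𝔽_l^±`-group of cusps (chart value `±1`;
KitCoreLabCusp). ([IUTchI] Def 6.1 (iii) p.156) [claim: Mochizuki2012, status: disputed] -/
theorem epsClass_eq_etaPMAbs : D.epsClass CG = (D.gLabPMModel CG).etaPMAbs := by
  apply (D.gLabPMModel CG).absStarEquiv.injective
  rw [D.absStarEquiv_epsClass CG, FlPMGroup.absStarEquiv_apply, (D.gLabPMModel CG).absStarLabel_etaPMAbs]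

/-- `Aut(𝒟^⊚)` moves the class of `ε̲` by its character: `absStarEquiv (α·[ε̲]) = toFlStarNF α` — so `α` fixes `[ε̲]` iff
`toFlStarNF α = 1` (print: `Aut_ε̲(C̲_K)` = the kernel of `Aut(C̲_K) → 𝔽_l^⋇`). ([IUTchI] Ex 4.3 (i) p.99) [claim: Mochizuki2012, status: disputed] -/
theorem gLabNFAutModel_epsClass_eq_iff (α : Aut (D.gBaseObj)) :
    D.gLabNFAutModel CG hS α (D.epsClass CG) = D.epsClass CG ↔ D.toFlStarNF CG hS α = 1 := by
  rw [← (D.gLabPMModel CG).absStarEquiv.injective.eq_iff, D.absStarEquiv_gLabNFAutModel CG hS, D.absStarEquiv_epsClass CG,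
    mul_one]

end InitialThetaData

end NFKitSlots

end Literature.IUT.HodgeTheaters
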